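import Mathlib
import HarnessLib
import Summits.AtomisticToContinuum.Crystallization.Theorems.PricedLinkCensusSoftLayerPropagationOneStackingMapSearchDefs

/-!
# One-stacking map engine (crux `SoftLayerPropagation`, line `Sketch` v7): the leaf check and the
# fuel-bounded search — definitions

Route `PricedLinkCensus`, crux `SoftLayerPropagation` (stmt-AtomisticToContinuum-14233), line
`Sketch`, stub `stub_oneStackingMap`.  Computable definitions only (sequel of
`…OneStackingMapSearchDefs.lean`): the level bookkeeping verified at a leaf, layer frames and the
decomposition of a shadow position into stacking coordinates, the LEAF CHECK (one Barlow stacking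
on the shadow ball of radius `33/10`: letters, membership, exact count), the search, its frontier
and the round-robin parts run by `native_decide` in `…OneStackingMapRunNN.lean`.  All [folklore].
-/

namespace Summit.AtomisticToContinuum.Crystallization.Theorems

namespace OneStacking

namespace St

/-! ### The leaf check: one Barlow stacking on the shadow ball of radius `33/10` -/

/-- The structural LEVEL BOOKKEEPING verified at a leaf: the centre has level `0`, levels are
non-decreasing along the array, and every recorded neighbour of an expanded site exists and is at
most one level up. [folklore] -/
def levelsOK (s : St) : Bool :=
  decide (s.lvl 0 = 0) &&
  (List.range s.size).all fun a =>
    (!decide (a + 1 < s.size) || decide (s.lvl a ≤ s.lvl (a + 1))) &&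
    (!decide (a < s.cur) || (s.nbrs a).all fun b => decide (b < s.size) && decide (s.lvl b ≤ s.lvl a + 1))

/-- A layer frame: in-layer generators `t₁, t₂` (`|tᵢ|² = 2S²`, `t₁·t₂ = S²`), the letter shift
`w = (t₁ + t₂)/3` and the layer step `z` (`|z|² = 4S²/3`, `z ⊥ t₁, t₂`). [folklore] -/
structure Frame where
  /-- first in-layer generator -/
  t1 : V3
  /-- second in-layer generator -/
  t2 : V3
  /-- letter shift -/
  w : V3
  /-- layer step -/
  z : V3
deriving Repr, DecidableEq

/-- The four frames: the four hexagonal directions of the FCC model (the HCP model's hexagonal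
direction is the first). [folklore] -/
def FRAMES : List Frame :=
  [⟨⟨S, 0, -S⟩, ⟨0, S, -S⟩, ⟨729, 729, -1458⟩, ⟨1458, 1458, 1458⟩⟩,
   ⟨⟨S, 0, S⟩, ⟨0, S, S⟩, ⟨729, 729, 1458⟩, ⟨1458, 1458, -1458⟩⟩,
   ⟨⟨S, 0, S⟩, ⟨0, -S, S⟩, ⟨729, -729, 1458⟩, ⟨1458, -1458, -1458⟩⟩,
   ⟨⟨-S, 0, S⟩, ⟨0, S, S⟩, ⟨-729, 729, 1458⟩, ⟨-1458, 1458, -1458⟩⟩]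

/-- The stacking point with layer `k`, in-layer coordinates `a, b` and letter `c`:
`a t₁ + b t₂ + c w + k z`. [folklore] -/
def Frame.pt (F : Frame) (k a b c : ℤ) : V3 :=
  V3.add (V3.add (V3.add (V3.smul a F.t1) (V3.smul b F.t2)) (V3.smul c F.w)) (V3.smul k F.z)

/-- Decompose a position in a frame: `some (k, a, b, c)` only if `p = F.pt k a b c` (verified by
recomputation) with `c ∈ {0, 1, 2}`. [folklore] -/
def Frame.decomp (F : Frame) (p : V3) : Option (ℤ × ℤ × ℤ × ℤ) :=
  let k : ℤ := ((V3.dot p F.z : ℚ) / (V3.dot F.z F.z : ℚ)).floor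
  let q := V3.sub p (V3.smul k F.z)
  let g11 : ℚ := V3.dot F.t1 F.t1; let g12 : ℚ := V3.dot F.t1 F.t2; let g22 : ℚ := V3.dot F.t2 F.t2
  let r1 : ℚ := V3.dot q F.t1; let r2 : ℚ := V3.dot q F.t2
  let d := g11 * g22 - g12 * g12
  let u := (r1 * g22 - r2 * g12) / d
  let v := (g11 * r2 - g12 * r1) / d
  let c := ((u - u.floor) * 3).floor
  let a := (u - c / 3).floor
  let b := (v - c / 3).floor
  if p = F.pt k a b c ∧ 0 ≤ c ∧ c ≤ 2 then some (k, a, b, c) else none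

/-- Inside the shadow ball of radius `33/10`: `100 |p|² ≤ 1089 · nn²`. [folklore] -/
def inBall (p : V3) : Bool := decide (100 * V3.n2 p ≤ 1089 * NN2)

/-- The sites of level `≤ 5` inside the shadow ball (indices). [folklore] -/
def inside (s : St) : List ℕ := (List.range s.size).filter fun a => s.lvl a ≤ 5 ∧ inBall (s.pos a)

/-- The letter of layer `k ∈ [-4, 4]` in a letter list (index `k + 4`; `0` out of range). [folklore] -/
def letter (L : List ℤ) (k : ℤ) : ℤ := L.getD (k + 4).toNat 0

/-- Letters read off the sites inside the ball (`-1` = unread); `none` if some site does not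
decompose, is outside the layers `-4 … 4`, or two sites of one layer disagree. [folklore] -/
def readLetters (F : Frame) (s : St) : Option (List ℤ) :=
  s.inside.foldl (fun acc a => match acc with
    | none => none
    | some L => match F.decomp (s.pos a) with
      | none => none
      | some (k, _, _, c) =>
        if k < -4 ∨ 4 < k then none
        else
          let old := letter L k
          if old = -1 then some (L.set (k + 4).toNat c) else if old = c then some L else none)
    (some (List.replicate 9 (-1)))

/-- Fill unread letters in all ways by `0, 1, 2`. [folklore] -/
def fills : List ℤ → List (List ℤ)
  | [] => [[]]
  | c :: cs => let r := fills cs; if c = -1 then [0, 1, 2].flatMap (fun d => r.map (d :: ·)) else r.map (c :: ·)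

/-- A letter list is admissible: nine letters in `{0, 1, 2}`, letter `0` on layer `0`,
consecutive letters different. [folklore] -/
def lettersOK (L : List ℤ) : Bool :=
  decide (L.length = 9) && decide (letter L 0 = 0) && L.all (fun c => decide (0 ≤ c ∧ c ≤ 2)) &&
    (List.range 8).all fun t => decide (L.getD t 0 ≠ L.getD (t + 1) 0)

/-- The box of stacking coordinates `|k| ≤ 4`, `|a|, |b| ≤ 8`. [folklore] -/
def BOX : List (ℤ × ℤ × ℤ) :=
  (List.range 9).flatMap fun ki => (List.range 17).flatMap fun ai => (List.range 17).map fun bi =>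
    ((ki : ℤ) - 4, (ai : ℤ) - 8, (bi : ℤ) - 8)

/-- **The leaf verdict for one frame and one letter list.**  Letters admissible; MEMBERSHIP:
every site of level `≤ 5` inside the ball decomposes in the frame with box coordinates and the
letter of its layer; COUNT: every box stacking point inside the ball is the position of EXACTLY
ONE such site (surjectivity, and — with membership — injectivity). [folklore] -/
def leafOK (F : Frame) (L : List ℤ) (s : St) : Bool :=
  let ins := s.inside
  lettersOK L &&
  (ins.all fun a => match F.decomp (s.pos a) with
    | none => false
    | some (k, a', b', c) => decide (-4 ≤ k ∧ k ≤ 4 ∧ -8 ≤ a' ∧ a' ≤ 8 ∧ -8 ≤ b' ∧ b' ≤ 8) &&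
        decide (letter L k = c)) &&
  (BOX.all fun kab =>
    let p := F.pt kab.1 kab.2.1 kab.2.2 (letter L kab.1)
    !inBall p || decide ((ins.filter fun a => s.pos a = p).length = 1))

/-- **The leaf witness**: the first frame and admissible completion of the letters read off the
sites that passes `leafOK`. [folklore] -/
def leafWitness (s : St) : Option (Frame × List ℤ) :=
  FRAMES.findSome? fun F => match readLetters F s with
    | none => none
    | some L0 => (fills L0).findSome? fun L => if leafOK F L s then some (F, L) else none

/-- The leaf check: level bookkeeping and a leaf witness. [folklore] -/
def leafCheck (s : St) : Bool := s.levelsOK && (leafWitness s).isSome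

/-! ### The search -/

/-- **The fuel-bounded development search.**  `true` means: every exact development realizing
the state satisfies the one-stacking conclusion.  A state whose cursor site has level `≥ 5`, or
without cursor site, is a leaf; exhausted fuel and `none` options (a non-spanning partial star or
a non-integral candidate — never met) give `false`. [folklore] -/
def search (tbl : List CEntry) : ℕ → St → Bool
  | 0, _ => false
  | fuel + 1, s =>
    if s.cur < s.size ∧ s.lvl s.cur ≤ 4 then
      match s.options tbl with
      | none => false
      | some opts => opts.all (search tbl fuel)
    else leafCheck s

/-- The states reached from `s` by expanding while the cursor level is `< d` (the FRONTIER at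
depth `d`), with fuel; `none` on a failure. [folklore] -/
def frontier (tbl : List CEntry) : ℕ → ℕ → St → Option (List St)
  | 0, _, _ => none
  | fuel + 1, d, s =>
    if s.cur < s.size ∧ s.lvl s.cur < d then
      match s.options tbl with
      | none => none
      | some opts => (opts.mapM (frontier tbl fuel d)).map List.flatten
    else some [s]

/-- Part `idx` of `parts` of the search below the depth-`d` frontier of the root (round robin),
each frontier state searched with fuel `fuel`. [folklore] -/
def checkPart (d parts idx fuel : ℕ) : Bool :=
  let tbl := TABLE
  match frontier tbl 4000 d root with
  | none => false
  | some fr => ((List.range fr.length).filter fun t => t % parts = idx).all fun t =>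
      match fr[t]? with
      | none => false
      | some s => search tbl fuel s

end St

end OneStacking

end Summit.AtomisticToContinuum.Crystallization.Theorems
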